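import Literature.IUT.HodgeArakelov.BadPrimeGaussianMonoidsCor36GenuineRecordOfTower
import Literature.IUT.HodgeArakelov.BadPrimeGaussianMonoidsGenuineRecordInftyProofs

/-!
# [IUTchII] Cor 3.6 (ii) «↷» END-TO-END AT THE GENUINE RECORD `EtaleLevels.thetaEnvRecordKummer`, `∞`-LEVEL (FAITHFUL
# FORM, UP TO TORSION): sequel to `BadPrimeGaussianMonoidsCor36GenuineRecordProofs.lean` (proof-only)

S. Mochizuki, *Inter-universal Teichmüller theory II*, kurims Dec-2020 manuscript, Cor 3.6 (ii) p. 100 (the `∞`-row of the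
third display and «each monoid `Ψ_{Fξ}(†F_v)` is equipped with a natural action by `G_v(M^Θ_*▶)_{⟨F_l^⋇⟩}`»), Cor 3.5 (ii) p. 95
(bracket l. 3–7 on the writer's render paper:url-5036b4059555: the `N`-th roots «are uniquely determined, up to multiplication
by an element of the `N`-torsion subgroup of `Ψ^×_cns(M^Θ_*)_{⟨F_l^⋇⟩}`»), Rmk 3.6.1 p. 101 [cite: Mochizuki2012, Cor 3.6 (ii) p.100].
Claim key DISPUTED (D-0012); nothing disputed is asserted here. PROOF-ONLY companion (abc-iut cell, layer L6, seat
abc-iut-w5-d192 gen 3; node **IUTchII:Cor3.6(ii)** «↷» at the `∞`-level, sub-DAG `plan/L6/SUBDAG-IUTchII-Cor-36.md` row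
Cor-36.ii.r9). NO definition, NO `Prop` fact.

WHAT IS PROVED (setting of the `Ψ`-level file: the genuine record `E := thetaEnvRecordKummer … c hA hfi O ι₀`, labeled copies
`(Ψ_{†C_v})_t` read as `O` with the labelwise action through the evaluation sections `s_t`, Kummer maps `f_t := R_t ∘ κ`):
* **`EtaleLevels.cor36ii_infty_thetaEnvRecordKummer_of_mem_thetaEnv`** — if `(R_t κ(y_t))_t ∈ ∏ R_t(∞Ψ^{i}_env)` then
  `(R_t κ(v_t · s_t(g) · y_t))_t ∈ ∏ R_t(∞Ψ^{i}_env)` for a family `(v_t)_t` of ROOTS OF UNITY of `O` — composing abc-iut-w4-d004's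
  `pi_restriction_inftyThetaMonoid_upToTorsion_thetaEnvRecordKummer_of_mem_thetaEnv` (p425905; the Cor 3.5 (ii) `∞`-level
  synchronization at the genuine record up to an `n`-torsion family), abc-iut-w5-d098's `exists_h1LimKummer_eq_of_isOfFinAddOrder`
  (torsion classes of the limit are Kummer classes of roots of unity), this seat's `hThetaU_thetaEnvRecordKummer` (p428301;
  Galois moves the `N`-th roots by units) and abc-iut-w5-d131's `splitMonoid_closure_conjStable` (`∞Ψ^{i}_env` is
  `s_{t₀}(g)`-stable).
* **`EtaleLevels.cor36ii_infty_thetaEnvRecordKummer_nonzeroIntegers_of_cyclotomeTower_rigid`** — the same for PRINT'S constant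
  monoid `O := 𝒪^▷_{ℚ̄_p} ≤ ℚ̄_pˣ` through `ε` with `q := ε`, every model-data input DISCHARGED: `(c, hc)` from abc-iut-w4-d043's chain
  tower (abc-iut-w4-d007 `exists_cyclotomeCoefficients_of_cyclotomeTower`, via this seat's `exists_cyclotomeCoefficients_mods`),
  `hOtors` (abc-iut-w5-d205), `hOroot` / `hO` (this seat's p429119), `hq` (this seat's `smul_eq_self_of_aug_eq_one`, p431165), `hlim`
  (abc-iut-w4-d030 `bijective_rigidLimHom`) — residual named inputs = model data + `IsEtThOrigin` (F-2498) + `IsCompact Δ_Θ`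
  (G-w5d187-1) + the sections DATA + `θ` + print's `hroots`.
INPUTS: the evaluation-sections data, `θ ∈ θ^{i₀}_env(𝕄_*)`, model data (`c` bijective `hc`, `O` `Π`-stable `hO` ⊇ torsion `hOtors`
and root-closed `hOroot` — discharged for print's `𝒪^▷_{ℚ̄_p}` in `…UnitsSaturationOfTower.lean` p429119 and abc-iut-w4-d007's
`…GenuineRecordTorsionOfTower.lean`), and print's root condition `hroots` on `∞θ^{i}_env` relative to `θ` (abc-iut-w4-d004
`hroots_toRecord` p427094 at the label of a Prop 2.2 (ii)′ datum; transported to conjugate labels by this seat's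
`…LabelTransportProofs`). HONEST FRAMING: composition of landed theorems; no side taken on [IUTchIII] Cor 3.12; typed ≠ proved
≠ endorsed.
-/

noncomputable section

namespace Literature.IUT.HodgeArakelov

namespace EtaleLevels

open Literature.AnabelianGeometry.EtaleTheta CohomologySystemOfContH1 EtaleThetaDataOfSetting TemperedThetaMonoids
  BadPrimeGaussianMonoids Literature.AnabelianGeometry.AbsoluteAnabelian

variable {p : ℕ} [Fact p.Prime] {D : Literature.AnabelianGeometry.EtaleTheta.ThetaSetting p}
  {E : D.EtaleThetaData} {l : ℕ} (C : E.DoubleUnderline l) (hC : D.Compat) (hS : D.Sec2Hyps)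
  (hl : l.Prime) (hp2 : p ≠ 2) (hpl : p ≠ l) (hζ : ∃ ζ : D.K, IsPrimitiveRoot ζ (4 * l))
  (mods : ∀ M : ℕ+, D.CyclotomeMod l M)
  (f : contCocycles D.toTheta D.DeltaTheta C.GtpYdduu) (hf : f ∈ C.rootCocycles hC)
  (hmods : ∀ (M M' : ℕ+) (h : (M : ℕ) ∣ (M' : ℕ)) (x : D.lDeltaTheta l),
    MuN.red p M M' h ((mods M').red x) = (mods M).red x)
  (h15 : Literature.AnabelianGeometry.EtaleTheta.ThetaSetting.Prop15iii E hC) (L : C.CuspLabels)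
  (hZ : ∀ M : ℕ+, Nonempty (ModelCyclotomes.lDeltaQuot (C.rigidData (mods M) hC hS h15 L) ≃*
    Literature.IUT.HodgeTheaters.ZHat))
  (hcharY : EtaleThetaDataOfSetting.PiYddCharacteristic C)
  (hlim : Function.Bijective (rigidLimHom C hC hS hl hp2 hpl hζ mods f hf hmods h15 L hZ))
  [(EtaleThetaDataOfSetting.PiYdd C).Normal]
  {A : Type} [CommGroup A] [MulDistribMulAction (Pi C) A] [TopologicalSpace A] [RootableBy A ℕ]
  (c : CyclotomeCoefficients (phi C) (D.lDeltaTheta l) A)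
  (hA : ∀ b : A, IsOpen (MulAction.stabilizer (Pi C) b : Set (Pi C)))
  (hfi : ∀ b : A, (MulAction.stabilizer (Pi C) b).FiniteIndex)
  (O : Submonoid A) (hO : ∀ (σ : Pi C) (b : A), b ∈ O → σ • b ∈ O) (ι₀ : Pi C)
  {Lbl : Type*} {P₀ : TopGroup.{0}} (φ₀ : P₀ →* D.GtpTheta) (s : Lbl → (P₀ →* Pi C))
  (hι : ∀ t, Continuous ((MonoidHom.id (Pi C)).comp (s t)))
  (hN : ∀ t, (⊤ : Subgroup P₀).map ((MonoidHom.id (Pi C)).comp (s t)) ≤ PiYdd C)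
  (hφ : ∀ t, (phi C).comp ((MonoidHom.id (Pi C)).comp (s t)) = φ₀)

/-- **[IUTchII] Cor 3.6 (ii) «↷», `∞`-LEVEL, FAITHFUL FORM UP TO TORSION, AT THE GENUINE RECORD** (p. 100 `∞`-row with
Cor 3.5 (ii) p. 95 bracket l. 3–7 and Rmk 3.6.1 p. 101), the copies read as `O`: for every `θ ∈ θ^{i₀}_env(𝕄_*)`, every label
`i` with print's root condition `hroots` on `∞θ^{i}_env` relative to `θ`, and every tuple `y : Lbl → O` whose labeled Kummer
classes lie in `∏ R_t(∞Ψ^{i}_env)`, the translated tuple `(s_t(g) · y_t)_t` lies there again UP TO a family `(v_t)_t` of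
ROOTS OF UNITY of `O`. Inputs = sections data + model data (`hc`, `hO`, `hOtors`, `hOroot`) + `hroots`; the junctions are
abc-iut-w4-d004's `pi_restriction_inftyThetaMonoid_upToTorsion_thetaEnvRecordKummer_of_mem_thetaEnv`, this seat's
`hThetaU_thetaEnvRecordKummer`, abc-iut-w5-d131's `splitMonoid_closure_conjStable`, and the torsion classes are Kummer
classes of roots of unity (abc-iut-w5-d098). [cite: Mochizuki2012, Cor 3.6 (ii) p.100] -/
theorem cor36ii_infty_thetaEnvRecordKummer_of_mem_thetaEnv (hc : Function.Bijective c.hom)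
    (hOtors : ∀ a : A, IsOfFinOrder a → a ∈ O ∧ a⁻¹ ∈ O)
    (hOroot : ∀ (a : A) (n : ℕ), 0 < n → a ^ n ∈ O → a ∈ O)
    {K : Type*} [Group K] (q : Pi C →* K) (hq : ∀ x : Pi C, q x = 1 → ∀ a ∈ O, x • a = a) (w : P₀ →* K)
    (hsec : ∀ t g, q (s t g) = w g) {i₀ : Pi C}
    {θ : (thetaEnvRecordKummer C hC hS hl hp2 hpl hζ mods f hf hmods h15 L hZ hcharY hlim c hA hfi O ι₀).H}
    (hθ : θ ∈ (thetaEnvRecordKummer C hC hS hl hp2 hpl hζ mods f hf hmods h15 L hZ hcharY hlim c hA hfi O ι₀).thetaEnv i₀)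
    (i : (thetaEnvRecordKummer C hC hS hl hp2 hpl hζ mods f hf hmods h15 L hZ hcharY hlim c hA hfi O ι₀).Iota)
    (hroots : ∀ ϑ ∈ (thetaEnvRecordKummer C hC hS hl hp2 hpl hζ mods f hf hmods h15 L hZ hcharY hlim c hA hfi O ι₀).inftyThetaEnv i,
      ∃ n : ℕ, 0 < n ∧ ϑ ^ n ∈
        splitMonoid (thetaEnvRecordKummer C hC hS hl hp2 hpl hζ mods f hf hmods h15 L hZ hcharY hlim c hA hfi O ι₀).units
          (Submonoid.powers θ))
    (R : Lbl → ((thetaEnvRecordKummer C hC hS hl hp2 hpl hζ mods f hf hmods h15 L hZ hcharY hlim c hA hfi O ι₀).H →*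
      Multiplicative (h1Lim φ₀ (D.lDeltaTheta l) (⊤ : Subgroup P₀) ⊥)))
    (hR : ∀ t y, Multiplicative.toAdd (R t y) =
      h1LimCongr (D.lDeltaTheta l) ⊤ (hφ t) ⊥
        (h1LimComap (phi C) (D.lDeltaTheta l) ((MonoidHom.id (Pi C)).comp (s t)) (hι t) (hN t)
          (AddEquiv.additiveMultiplicative (h1Lim (phi C) (D.lDeltaTheta l) (PiYdd C) ⊥) (Additive.ofMul y))))
    (t₀ : Lbl) (g : P₀) {y : Lbl → O}
    (hy : (fun t => R t (h1LimKummerOn (phi C) (D.lDeltaTheta l) (PiYdd C) c hA hfi O (y t))) ∈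
      ((thetaEnvRecordKummer C hC hS hl hp2 hpl hζ mods f hf hmods h15 L hZ hcharY hlim c hA hfi O ι₀).inftyThetaMonoid i).map
        (MonoidHom.pi R)) :
    ∃ v : Lbl → O, (∀ t, IsOfFinOrder (v t)) ∧
      (fun t => R t (h1LimKummerOn (phi C) (D.lDeltaTheta l) (PiYdd C) c hA hfi O
          (v t * ⟨(s t g) • ((y t : O) : A), hO (s t g) _ (y t).2⟩))) ∈
        ((thetaEnvRecordKummer C hC hS hl hp2 hpl hζ mods f hf hmods h15 L hZ hcharY hlim c hA hfi O ι₀).inftyThetaMonoid i).map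
          (MonoidHom.pi R) := by
  obtain ⟨z, hz, hzy⟩ := hy
  -- Cor 3.5 (ii) at `∞Ψ^{i}_env` (abc-iut-w4-d004): synchronization up to an `n`-torsion family `u`
  obtain ⟨n, u, hn, hun, hsync⟩ :=
    pi_restriction_inftyThetaMonoid_upToTorsion_thetaEnvRecordKummer_of_mem_thetaEnv C hC hS hl hp2 hpl hζ mods f hf
      hmods h15 L hZ hcharY hlim c hA hfi O hO ι₀ φ₀ s hι hN hφ q hq w hsec hθ i hroots R hR hz t₀ g
  -- each `u t` is the Kummer class of a root of unity `ζ t ∈ O` (abc-iut-w5-d098 + `hOtors`)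
  have hv : ∀ t, ∃ ζ : A, IsOfFinOrder ζ ∧
      h1LimKummer (phi C) (D.lDeltaTheta l) (PiYdd C) c hA hfi ζ = u t := by
    intro t
    have hut₀ : IsOfFinOrder (u t) := isOfFinOrder_iff_pow_eq_one.mpr ⟨n, hn, hun t⟩
    have hut : IsOfFinAddOrder
        (Multiplicative.toAdd (α := h1Lim (phi C) (D.lDeltaTheta l) (PiYdd C) ⊥) (u t)) :=
      (isOfFinOrder_ofAdd_iff (α := h1Lim (phi C) (D.lDeltaTheta l) (PiYdd C) ⊥)
        (x := Multiplicative.toAdd (α := h1Lim (phi C) (D.lDeltaTheta l) (PiYdd C) ⊥) (u t))).mp hut₀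
    obtain ⟨ζr, hζr, hζreq⟩ :=
      exists_h1LimKummer_eq_of_isOfFinAddOrder (phi C) (D.lDeltaTheta l) (PiYdd C) c hA hfi hc _ hut
    exact ⟨ζr, hζr, hζreq⟩
  choose ζr hζr hζreq using hv
  refine ⟨fun t => ⟨ζr t, (hOtors (ζr t) (hζr t)).1⟩, fun t => ?_, ?_⟩
  · obtain ⟨m, hm, hζm⟩ := (hζr t).exists_pow_eq_one
    exact isOfFinOrder_iff_pow_eq_one.mpr
      ⟨m, hm, Subtype.ext (by rw [SubmonoidClass.coe_pow, OneMemClass.coe_one]; exact hζm)⟩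
  · -- the new tuple IS `∏ R_t (s_{t₀}(g) · z)`, and `s_{t₀}(g) · z ∈ ∞Ψ^{i}_env` (units stable, `hΘU`)
    have key : (fun t => R t (h1LimKummerOn (phi C) (D.lDeltaTheta l) (PiYdd C) c hA hfi O
        ((⟨ζr t, (hOtors (ζr t) (hζr t)).1⟩ : O) * ⟨(s t g) • ((y t : O) : A), hO (s t g) _ (y t).2⟩))) =
        (fun t => R t (u t)) * piIso Lbl (h1LimConjMulAut φ₀ (D.lDeltaTheta l) ⊤ g)
          (fun t => R t (h1LimKummerOn (phi C) (D.lDeltaTheta l) (PiYdd C) c hA hfi O (y t))) := by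
      funext t
      -- `R_t (κ (ζ_t · σy)) = R_t (κ ζ_t) · R_t (κ σy)` (multiplicativity, stated at the record's carrier)
      have hmul : R t (h1LimKummerOn (phi C) (D.lDeltaTheta l) (PiYdd C) c hA hfi O
          ((⟨ζr t, (hOtors (ζr t) (hζr t)).1⟩ : O) * ⟨(s t g) • ((y t : O) : A), hO (s t g) _ (y t).2⟩)) =
          R t (h1LimKummerOn (phi C) (D.lDeltaTheta l) (PiYdd C) c hA hfi O ⟨ζr t, (hOtors (ζr t) (hζr t)).1⟩) *
          R t (h1LimKummerOn (phi C) (D.lDeltaTheta l) (PiYdd C) c hA hfi O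
            ⟨(s t g) • ((y t : O) : A), hO (s t g) _ (y t).2⟩) :=
        (congrArg (R t) (map_mul (h1LimKummerOn (phi C) (D.lDeltaTheta l) (PiYdd C) c hA hfi O) _ _)).trans
          (map_mul (R t) _ _)
      -- `R_t (κ ζ_t) = R_t (u_t)`
      have hκζ : R t (h1LimKummerOn (phi C) (D.lDeltaTheta l) (PiYdd C) c hA hfi O ⟨ζr t, (hOtors (ζr t) (hζr t)).1⟩) =
          R t (u t) := congrArg (R t) (hζreq t)
      change _ = R t (u t) * h1LimConjMulAut φ₀ (D.lDeltaTheta l) ⊤ g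
        (R t (h1LimKummerOn (phi C) (D.lDeltaTheta l) (PiYdd C) c hA hfi O (y t)))
      rw [hmul, hκζ,
        kummer_smul_restriction_eq_thetaEnvRecordKummer C hC hS hl hp2 hpl hζ mods f hf hmods h15 L hZ hcharY hlim
          c hA hfi O hO ι₀ φ₀ s hι hN hφ R hR t g (y t)]
    have hzstab : (thetaEnvRecordKummer C hC hS hl hp2 hpl hζ mods f hf hmods h15 L hZ hcharY hlim c hA hfi O ι₀).conj
        (s t₀ g) z ∈
        (thetaEnvRecordKummer C hC hS hl hp2 hpl hζ mods f hf hmods h15 L hZ hcharY hlim c hA hfi O ι₀).inftyThetaMonoid i :=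
      splitMonoid_closure_conjStable
        (thetaEnvRecordKummer C hC hS hl hp2 hpl hζ mods f hf hmods h15 L hZ hcharY hlim c hA hfi O ι₀).conj
        (thetaEnvRecordKummer C hC hS hl hp2 hpl hζ mods f hf hmods h15 L hZ hcharY hlim c hA hfi O ι₀).units
        ((thetaEnvRecordKummer C hC hS hl hp2 hpl hζ mods f hf hmods h15 L hZ hcharY hlim c hA hfi O ι₀).inftyThetaEnv i)
        (s t₀ g)
        (fun u' hu' => units_stable_thetaEnvRecord C hC hS hl hp2 hpl hζ mods f hf hmods h15 L hZ hcharY hlim c hA hfi O hO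
          ι₀ (s t₀ g) u' hu')
        (hThetaU_thetaEnvRecordKummer C hC hS hl hp2 hpl hζ mods f hf hmods h15 L hZ hcharY hlim c hA hfi O hO ι₀ hc
          hOtors hOroot s hN hθ i hroots g t₀)
        z hz
    rw [key, ← hzy, ← hsync]
    exact ⟨_, hzstab, rfl⟩

/-- **[IUTchII] Cor 3.6 (ii) «↷», `∞`-LEVEL UP TO TORSION, AT THE GENUINE RECORD with PRINT'S constant monoid
`O := 𝒪^▷_{ℚ̄_p} ≤ ℚ̄_pˣ` through `ε` and `q := ε`, every model-data input DISCHARGED** (`(c, hc)` from the chain tower, `hOtors`,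
`hOroot`, `hO`, `hq`, `hlim`): for every family of continuous evaluation sections `s_t : Π₀ → Π^tp_{X̲̲}` landing in `Π^tp_{Ÿ̲̲}` with
common coefficient action `φ₀` that are sections of `ε` up to one identification `w`, there is a bijective coefficient datum `c`,
pinned by the level formula `(mods M).red (c ζ) = ζ_M`, such that for every `θ ∈ θ^{i₀'}_env(𝕄_*)`, every label `i` with print's
root condition `hroots` relative to `θ`, and every tuple `y : Lbl → 𝒪^▷_{ℚ̄_p}` whose labeled Kummer classes lie in
`∏ R_t(∞Ψ^{i}_env)`, the translate `(s_t(g) · y_t)_t` lies there again up to a family of ROOTS OF UNITY.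
[claim: Mochizuki2012, status: disputed] (IUTchII §3 Cor 3.6 (ii), kurims p.100) -/
theorem cor36ii_infty_thetaEnvRecordKummer_nonzeroIntegers_of_cyclotomeTower_rigid (hO' : D.IsEtThOrigin)
    (hΔ : IsCompact (D.DeltaTheta : Set D.GtpTheta)) (w : P₀ →* Literature.AnabelianGeometry.SemiGraphs.GQp p)
    (hsec : ∀ t g, aug C (s t g) = w g) :
    ∃ c : CyclotomeCoefficients (phi C) (D.lDeltaTheta l) (PadicAlgCl p)ˣ,
      Function.Bijective c.hom ∧
      (∀ (ζ : Literature.AnabelianGeometry.EtaleTheta.cyclotome (PadicAlgCl p)ˣ) (M : ℕ+),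
        (((mods M).red (c.hom ζ) : MuN p M) : (PadicAlgCl p)ˣ) = (ζ : ℕ+ → (PadicAlgCl p)ˣ) M) ∧
      ∀ {i₀ : Pi C}
        {θ : (thetaEnvRecordKummer C hC hS hl hp2 hpl hζ mods f hf hmods h15 L hZ hcharY
          (bijective_rigidLimHom C hC hS hl hp2 hpl hζ mods f hf hmods h15 L hZ) c (isOpen_stabilizer_units C)
          (finiteIndex_stabilizer_units C) ((nonzeroIntegers ℚ_[p] (PadicAlgCl p)).comap (Units.coeHom (PadicAlgCl p)))
          ι₀).H},
        θ ∈ (thetaEnvRecordKummer C hC hS hl hp2 hpl hζ mods f hf hmods h15 L hZ hcharY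
          (bijective_rigidLimHom C hC hS hl hp2 hpl hζ mods f hf hmods h15 L hZ) c (isOpen_stabilizer_units C)
          (finiteIndex_stabilizer_units C) ((nonzeroIntegers ℚ_[p] (PadicAlgCl p)).comap (Units.coeHom (PadicAlgCl p)))
          ι₀).thetaEnv i₀ →
        ∀ (i : (thetaEnvRecordKummer C hC hS hl hp2 hpl hζ mods f hf hmods h15 L hZ hcharY
          (bijective_rigidLimHom C hC hS hl hp2 hpl hζ mods f hf hmods h15 L hZ) c (isOpen_stabilizer_units C)
          (finiteIndex_stabilizer_units C) ((nonzeroIntegers ℚ_[p] (PadicAlgCl p)).comap (Units.coeHom (PadicAlgCl p)))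
          ι₀).Iota),
        (∀ ϑ ∈ (thetaEnvRecordKummer C hC hS hl hp2 hpl hζ mods f hf hmods h15 L hZ hcharY
            (bijective_rigidLimHom C hC hS hl hp2 hpl hζ mods f hf hmods h15 L hZ) c (isOpen_stabilizer_units C)
            (finiteIndex_stabilizer_units C) ((nonzeroIntegers ℚ_[p] (PadicAlgCl p)).comap (Units.coeHom (PadicAlgCl p)))
            ι₀).inftyThetaEnv i,
          ∃ n : ℕ, 0 < n ∧ ϑ ^ n ∈
            splitMonoid (thetaEnvRecordKummer C hC hS hl hp2 hpl hζ mods f hf hmods h15 L hZ hcharY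
              (bijective_rigidLimHom C hC hS hl hp2 hpl hζ mods f hf hmods h15 L hZ) c (isOpen_stabilizer_units C)
              (finiteIndex_stabilizer_units C) ((nonzeroIntegers ℚ_[p] (PadicAlgCl p)).comap (Units.coeHom (PadicAlgCl p)))
              ι₀).units (Submonoid.powers θ)) →
        ∀ (R : Lbl → ((thetaEnvRecordKummer C hC hS hl hp2 hpl hζ mods f hf hmods h15 L hZ hcharY
            (bijective_rigidLimHom C hC hS hl hp2 hpl hζ mods f hf hmods h15 L hZ) c (isOpen_stabilizer_units C)
            (finiteIndex_stabilizer_units C) ((nonzeroIntegers ℚ_[p] (PadicAlgCl p)).comap (Units.coeHom (PadicAlgCl p)))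
            ι₀).H →* Multiplicative (h1Lim φ₀ (D.lDeltaTheta l) (⊤ : Subgroup P₀) ⊥))),
          (∀ t y, Multiplicative.toAdd (R t y) =
            h1LimCongr (D.lDeltaTheta l) ⊤ (hφ t) ⊥
              (h1LimComap (phi C) (D.lDeltaTheta l) ((MonoidHom.id (Pi C)).comp (s t)) (hι t) (hN t)
                (AddEquiv.additiveMultiplicative (h1Lim (phi C) (D.lDeltaTheta l) (PiYdd C) ⊥) (Additive.ofMul y)))) →
          ∀ (t₀ : Lbl) (g : P₀) {y : Lbl → (nonzeroIntegers ℚ_[p] (PadicAlgCl p)).comap (Units.coeHom (PadicAlgCl p))},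
            (fun t => R t (h1LimKummerOn (phi C) (D.lDeltaTheta l) (PiYdd C) c (isOpen_stabilizer_units C)
                (finiteIndex_stabilizer_units C)
                ((nonzeroIntegers ℚ_[p] (PadicAlgCl p)).comap (Units.coeHom (PadicAlgCl p))) (y t))) ∈
              ((thetaEnvRecordKummer C hC hS hl hp2 hpl hζ mods f hf hmods h15 L hZ hcharY
                (bijective_rigidLimHom C hC hS hl hp2 hpl hζ mods f hf hmods h15 L hZ) c (isOpen_stabilizer_units C)
                (finiteIndex_stabilizer_units C) ((nonzeroIntegers ℚ_[p] (PadicAlgCl p)).comap (Units.coeHom (PadicAlgCl p)))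
                ι₀).inftyThetaMonoid i).map (MonoidHom.pi R) →
            ∃ v : Lbl → (nonzeroIntegers ℚ_[p] (PadicAlgCl p)).comap (Units.coeHom (PadicAlgCl p)),
              (∀ t, IsOfFinOrder (v t)) ∧
              (fun t => R t (h1LimKummerOn (phi C) (D.lDeltaTheta l) (PiYdd C) c (isOpen_stabilizer_units C)
                  (finiteIndex_stabilizer_units C)
                  ((nonzeroIntegers ℚ_[p] (PadicAlgCl p)).comap (Units.coeHom (PadicAlgCl p)))
                  (v t * ⟨(s t g) • ((y t : (nonzeroIntegers ℚ_[p] (PadicAlgCl p)).comap (Units.coeHom (PadicAlgCl p))) :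
                      (PadicAlgCl p)ˣ), smul_mem_comap_nonzeroIntegers_padic C (s t g) (y t).2⟩))) ∈
                ((thetaEnvRecordKummer C hC hS hl hp2 hpl hζ mods f hf hmods h15 L hZ hcharY
                  (bijective_rigidLimHom C hC hS hl hp2 hpl hζ mods f hf hmods h15 L hZ) c (isOpen_stabilizer_units C)
                  (finiteIndex_stabilizer_units C) ((nonzeroIntegers ℚ_[p] (PadicAlgCl p)).comap (Units.coeHom (PadicAlgCl p)))
                  ι₀).inftyThetaMonoid i).map (MonoidHom.pi R) := by
  obtain ⟨c, hc, hlev⟩ := exists_cyclotomeCoefficients_mods C mods hmods hO' hΔ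
  refine ⟨c, hc, hlev, fun {i₀} {θ} hθ i hroots R hR t₀ g y hy => ?_⟩
  exact cor36ii_infty_thetaEnvRecordKummer_of_mem_thetaEnv C hC hS hl hp2 hpl hζ mods f hf hmods h15 L hZ hcharY
    (bijective_rigidLimHom C hC hS hl hp2 hpl hζ mods f hf hmods h15 L hZ) c (isOpen_stabilizer_units C)
    (finiteIndex_stabilizer_units C) ((nonzeroIntegers ℚ_[p] (PadicAlgCl p)).comap (Units.coeHom (PadicAlgCl p)))
    (fun σ _ hb => smul_mem_comap_nonzeroIntegers_padic C σ hb) ι₀ φ₀ s hι hN hφ hc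
    (fun a ha => ⟨mem_comap_nonzeroIntegers_padic_of_isOfFinOrder' ha,
      mem_comap_nonzeroIntegers_padic_of_isOfFinOrder' ha.inv⟩)
    (fun _ _ hn ha => mem_comap_nonzeroIntegers_of_pow_mem hn ha) (aug C)
    (fun _ hy' a _ => smul_eq_self_of_aug_eq_one C hy' a) w hsec hθ i hroots R hR t₀ g hy

end EtaleLevels

end Literature.IUT.HodgeArakelov

end
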